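import Summits.BirchSwinnertonDyer.BirchSwinnertonDyer.Theses.PrintX9
import Summits.BirchSwinnertonDyer.BirchSwinnertonDyer.Theorems.PrintX9AssemblyLightFramePinned
import Summits.BirchSwinnertonDyer.BirchSwinnertonDyer.Theorems.PrintX9PrintMuCGEntry
import Summits.BirchSwinnertonDyer.BirchSwinnertonDyer.Theorems.PrintX9TwoSidedLinkPinnedOfPrint
import Summits.BirchSwinnertonDyer.BirchSwinnertonDyer.Theorems.PrintX9MuInequalityCoherentPairOfPrintCG
import Literature.NumberTheory.EllipticCurves.AnticyclotomicTowerSharpProofs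
import HarnessLib

/-!
# T-G (X9) — DISPLAY: the X9 leaf from the TEN by-name print leaves and the two K6 μ-inputs only

Turnkey of pen plan g14 (HOME/plan/turnkeys/g14-postclosure/), landed by width seat x10b-p1-w5 g4 AFTER item
stmt-BirchSwinnertonDyer-23428 `MuInequalityCoherentPairOfPrintCG` was CLOSED·proved; the μ-binder hM is discharged BY NAME by the
μ-LEAD's closing theorem `HeegnerMuPartOfPrintCGClosed.muInequalityCoherentPairOfPrintCG_holds`
(module `Theorems.PrintX9MuInequalityCoherentPairOfPrintCG`). Row 9 of the D-0131 print tier in PARTITION currency: the route's deciding theorem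
`Theses.PrintX9.closes` (rev 50) with every CLOSED binder discharged BY NAME — hAsm (26361), hM (23428), hG (23429),
hB (26360) — leaving exactly the ten cite-only print leaves hH hK hCG hMZ hNV hCGS hTw hPT hHP hCP (each a `def … : Prop`
typed verbatim from the printed theorem, referee-policed) and the two K6-shared μ-cruxes hT (19629 MuTransfer, HELD) /
hμ (19630 AnalyticMuZeroX9). `#print axioms` must be ⊆ {propext, Classical.choice, Quot.sound}. BSD is NOT proved by this
file; no print leaf is discharged here. Proposal: `ledger propose --kind proof --target
Summits/BirchSwinnertonDyer/BirchSwinnertonDyer/Theorems/PrintX9LeafOfPrintLeaves.lean --supports stmt-BirchSwinnertonDyer-23428 --as helper`.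
APPEND (x10b-p1-w5 g4, after Tower♯ p681041): `bsdpOnClassX9_of_nineLeaves` — the same leaf from NINE print leaves
(+ hT/hμ), the binder hTw `AnticyclotomicTowerSharp` discharged BY NAME by `Literature.NumberTheory.EllipticCurves.anticyclotomicTowerSharp`.
-/

namespace Summit.BirchSwinnertonDyer.BirchSwinnertonDyer.Theorems.PrintX9LeafOfPrintLeaves

-- `Summit.<Summit>.<Sub>.…` with Summit = Sub (D-0017): the linter flags it by design
set_option linter.dupNamespace false

open Summit.BirchSwinnertonDyer.BirchSwinnertonDyer.Theses.PrintX9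

/-- Row 9 display: BSD_p on the X9 leaf `Rank1Residual.BSDpOnClassX9` from the ten by-name print leaves and the two
K6-shared μ-inputs, every other binder of `PrintX9.closes` being a kernel theorem. -/
theorem bsdpOnClassX9_of_printLeaves
    (hH : HowardDVRKolyvaginBound) (hK : CGLSHeegnerKolyvaginSystem) (hCG : CoatesGreenbergKummerImage)
    (hMZ : MastellaZermanHowardDivisibility) (hNV : CGLSHeegnerClassNonvanishing)
    (hCGS : CGSHowardDivisibilityPLocalized) (hTw : AnticyclotomicTowerSharp) (hPT : PinnedTransferPrintFacts)
    (hHP : HeegnerPrintFactsX9) (hCP : CyclotomicPrintFactsX9)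
    (hT : MuTransfer) (hμ : AnalyticMuZeroX9) :
    Summit.BirchSwinnertonDyer.BirchSwinnertonDyer.Rank1Residual.BSDpOnClassX9 :=
  closes Summit.BirchSwinnertonDyer.BirchSwinnertonDyer.Rank1Residual.TorsionLayerPinned.assemblyLightFramePinned_holds
    hH hK hCG hMZ hNV hCGS hTw hPT
    Summit.BirchSwinnertonDyer.BirchSwinnertonDyer.Theorems.HeegnerMuPartOfPrintCGClosed.muInequalityCoherentPairOfPrintCG_holds
    Summit.BirchSwinnertonDyer.BirchSwinnertonDyer.Theorems.PrintX9PrintMuCGEntry.howardContainmentLightFramePinnedOfPrintSharpOfPrintMuCG_holds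
    Summit.BirchSwinnertonDyer.BirchSwinnertonDyer.Theorems.PrintX9Pinned.twoSidedLinkPinnedOfPrint_holds
    hT hμ hHP hCP

/-- Row 9 display, NINE leaves (append 2026-08-29, x10b-p1-w5 g4): BSD_p on the X9 leaf `Rank1Residual.BSDpOnClassX9`
from the nine remaining cite-only print leaves hH hK hCG hMZ hNV hCGS hPT hHP hCP and the two K6-shared μ-inputs hT hμ —
the binder `AnticyclotomicTowerSharp` of `PrintX9.closes` (Tower♯, item stmt-BirchSwinnertonDyer-27076: `K_k ⊆ K[p^{k+1}]`
for the anticyclotomic ℤ_p-extension of an imaginary quadratic field, p odd) is DISCHARGED BY NAME by the unconditional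
kernel theorem `Literature.NumberTheory.EllipticCurves.anticyclotomicTowerSharp` (x10b-p1-w2 g12, p681041; class field
theory over the tree, with x9-p1-w4 g10 p680094 and bsd-line-x10b-p1 LEAD g10 p680687). Display only; BSD is NOT proved
here. -/
theorem bsdpOnClassX9_of_nineLeaves
    (hH : HowardDVRKolyvaginBound) (hK : CGLSHeegnerKolyvaginSystem) (hCG : CoatesGreenbergKummerImage)
    (hMZ : MastellaZermanHowardDivisibility) (hNV : CGLSHeegnerClassNonvanishing)
    (hCGS : CGSHowardDivisibilityPLocalized) (hPT : PinnedTransferPrintFacts)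
    (hHP : HeegnerPrintFactsX9) (hCP : CyclotomicPrintFactsX9)
    (hT : MuTransfer) (hμ : AnalyticMuZeroX9) :
    Summit.BirchSwinnertonDyer.BirchSwinnertonDyer.Rank1Residual.BSDpOnClassX9 :=
  bsdpOnClassX9_of_printLeaves hH hK hCG hMZ hNV hCGS
    Literature.NumberTheory.EllipticCurves.anticyclotomicTowerSharp hPT hHP hCP hT hμ

end Summit.BirchSwinnertonDyer.BirchSwinnertonDyer.Theorems.PrintX9LeafOfPrintLeaves
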